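import Literature.NumberTheory.EllipticCurves.TateModule
import HarnessLib

/-!
# Transfer of Tate-module data along a reduction map

Topic `Literature/NumberTheory/EllipticCurves` (the generic Tate module `TateModule A p` of
`TateModule.lean`).  A *reduction datum* for an abelian group `A` with an action of a group `Γ`
(e.g. `A = Pic(C_{K̄})` with `Γ = Γ_K`) towards an abelian group `B` with an action of a group `H`
(e.g. `B = Pic(C̄_{κ̄})` with `H = Gal(κ̄/k)`) is an additive map `red : A →+ B`, a subgroup `Δ ≤ Γ`
(decomposition group) with a homomorphism `r : Δ →* H`, the equivariance `red (τ c) = r(τ) red c`,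
and injectivity of `red` on `p`-power torsion.  This file records the three formal consequences used
by good-reduction arguments (Serre–Tate, *Good reduction of abelian varieties*, §1, Lemma 2 and
Thm. 1, where the reduction map is an isomorphism on prime-to-`p` torsion):

* `TateModule.map_injective_of_forall_torsionBy` — `T_p(red) : T_p A → T_p B` is injective;
* `TateModule.smul_eq_self_of_reduction` — an element of `Δ` acting trivially on `B` (e.g. inertia)
  acts trivially on `T_p A` (**criterion of Néron–Ogg–Shafarevich, easy direction**);
* `TateModule.map_comp_toLinearMap_eq` — `T_p(red)` intertwines the action of `τ ∈ Δ` (resp. of any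
  commuting pair of operators, e.g. deck transformations) on `T_p A` with that of `r(τ)` on `T_p B`,
  so that traces agree when both Tate modules are free of the same rank
  (`PadicEisensteinOrder.trace_eq_of_injective_of_comp_eq`).

Everything is proved; no named facts.

## References
* J.-P. Serre, J. Tate, *Good reduction of abelian varieties*, Ann. of Math. 88 (1968), §1, Lemma 2,
  Thm. 1. [SerreTate1968GoodReduction]
-/

noncomputable section

namespace Literature.NumberTheory.EllipticCurves

namespace TateModule

universe u v

variable {A : Type u} [AddCommGroup A] {B : Type v} [AddCommGroup B] {p : ℕ} [Fact p.Prime]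

/-- **`T_p(red)` is injective when `red` is injective on `p`-power torsion.**
[cite: SerreTate1968GoodReduction, §1 Lemma 2] -/
theorem map_injective_of_forall_torsionBy (red : A →+ B)
    (hinj : ∀ (n : ℕ) (c : A), p ^ n • c = 0 → red c = 0 → c = 0) :
    Function.Injective (map p red) := by
  intro x y hxy
  rw [← sub_eq_zero]
  refine TateModule.ext fun n => ?_
  have h1 : proj p n (x - y) = proj p n x - proj p n y := map_sub (proj p n) x y
  rw [map_zero]
  refine hinj n _ (pow_smul_proj n (x - y)) ?_
  rw [h1, map_sub, ← proj_map, ← proj_map, hxy, sub_self]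

section Action

variable {Γ : Type*} [Group Γ] [DistribMulAction Γ A] {H : Type*} [Monoid H] [DistribMulAction H B]

omit [Fact p.Prime] in
/-- **Inertia acts trivially on the Tate module under good reduction** (formal part): if `red (σ c) = red c`
for all `c` (e.g. `σ` lies in the kernel of `Δ → Aut(κ̄/k)`) and `red` is injective on `p`-power torsion,
then `σ` acts trivially on `T_p A`. [cite: SerreTate1968GoodReduction, §1 Thm. 1] -/
theorem smul_eq_self_of_reduction (red : A →+ B)
    (hinj : ∀ (n : ℕ) (c : A), p ^ n • c = 0 → red c = 0 → c = 0) (σ : Γ)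
    (hσ : ∀ c : A, red (σ • c) = red c) (t : TateModule A p) : σ • t = t := by
  refine TateModule.ext fun n => ?_
  rw [proj_smul_of_distribMulAction, ← sub_eq_zero]
  refine hinj n _ ?_ ?_
  · rw [smul_sub, smul_comm, pow_smul_proj, smul_zero, sub_self]
  · rw [map_sub, hσ, sub_self]

/-- **`T_p(red)` intertwines equivariant operators**: if `red (σ c) = h • red c` for all `c`, then
`T_p(red) ∘ T_p(σ) = T_p(h) ∘ T_p(red)`. [cite: SerreTate1968GoodReduction, §1] -/
theorem map_smul_of_reduction (red : A →+ B) (σ : Γ) (h : H) (hσ : ∀ c : A, red (σ • c) = h • red c)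
    (t : TateModule A p) : map p red (σ • t) = h • map p red t := by
  refine TateModule.ext fun n => ?_
  rw [proj_map, proj_smul_of_distribMulAction, hσ, proj_smul_of_distribMulAction, proj_map]

/-- `map_smul_of_reduction` for a product of two operators on each side (e.g. a Frobenius composed with
a deck transformation): `T_p(red) (σ (ζ t)) = h (η (T_p(red) t))`. [folklore] -/
theorem map_smul_smul_of_reduction {Z : Type*} [Monoid Z] [DistribMulAction Z A] {Y : Type*} [Monoid Y]
    [DistribMulAction Y B] (red : A →+ B) (σ : Γ) (h : H) (hσ : ∀ c : A, red (σ • c) = h • red c)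
    (ζ : Z) (η : Y) (hζ : ∀ c : A, red (ζ • c) = η • red c) (t : TateModule A p) :
    map p red (σ • (ζ • t)) = h • (η • map p red t) := by
  refine TateModule.ext fun n => ?_
  rw [proj_map, proj_smul_of_distribMulAction, proj_smul_of_distribMulAction, hσ, hζ,
    proj_smul_of_distribMulAction, proj_smul_of_distribMulAction, proj_map]

/-- The linear-map form of `map_smul_smul_of_reduction`:
`T_p(red) ∘ (T_p(σ) ∘ T_p(ζ)) = (T_p(h) ∘ T_p(η)) ∘ T_p(red)` as `ℤ_p`-linear maps. [folklore] -/
theorem map_comp_toLinearMap_eq {Z : Type*} [Monoid Z] [DistribMulAction Z A] {H' : Type*} [Group H']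
    [DistribMulAction H' B] {Y : Type*} [Monoid Y] [DistribMulAction Y B]
    (red : A →+ B) (σ : Γ) (h : H') (hσ : ∀ c : A, red (σ • c) = h • red c)
    (ζ : Z) (η : Y) (hζ : ∀ c : A, red (ζ • c) = η • red c) :
    map p red ∘ₗ (DistribSMul.toLinearMap ℤ_[p] (TateModule A p) σ ∘ₗ DistribSMul.toLinearMap ℤ_[p] (TateModule A p) ζ) =
      (DistribSMul.toLinearMap ℤ_[p] (TateModule B p) h ∘ₗ DistribSMul.toLinearMap ℤ_[p] (TateModule B p) η) ∘ₗ
        map p red :=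
  LinearMap.ext fun t => map_smul_smul_of_reduction red σ h hσ ζ η hζ t

end Action

end TateModule

end Literature.NumberTheory.EllipticCurves

end
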